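import Summits.KontsevichZagierPeriods.KontsevichZagierPeriods.Theorems.HurwitzMicroSectorsNormalFormPrincipleL2W3HalfPointZetaTwoLogTwo
import Summits.KontsevichZagierPeriods.KontsevichZagierPeriods.Theorems.HurwitzMicroSectorsNormalFormPrincipleL2W3HalfPointDuality
import Summits.KontsevichZagierPeriods.KontsevichZagierPeriods.Theorems.HurwitzMicroSectorsNormalFormPrincipleM3KernelReduceHalfPoint
import Literature.NumberTheory.Transcendental.KZSubcalculusInvariants

/-!
# `NormalFormPrinciple` (stmt-KontsevichZagierPeriods-3869), line `SketchIdeator1` —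
# M3 kernel capstone, stub K3b: reductions of the `ζ(2)log 2`-valued and half-point box families

Pure proof file (registered sub-goal `m3k_reduce_log`, lead seat c9; `--supports` the crux).
The kernel capstone reduces every generator `N` of the subgroup of `KZ.FormalRep` spanned by the
eleven dimension-three box families of the six `m3` instances, after doubling, to
`α•[Z] + β•[Q]` modulo `KZ.relations`, where `Z` is any carrier of `[(0,1)³, 1/(1−xyz)]`
(value `ζ(3)`) and `Q` any carrier of `[(0,1)³, 1/((1−xy)(1+z))]` (value `ζ(2)log 2`). This file
treats the five families with `β ≠ 0`:

* `1/((1−xy)(1+z))` ↦ `2[Q]` — congruence (rule (1b) with a zero representation);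
* `3/((1−xy)(1+z))` ↦ `6[Q]` — congruence with the scaled carrier `Q.constMul 3` and the
  bookkeeping `[σ, 3g] − 3[σ, g] ∈ relations` (iterated rule (1b));
* `4/((2−x)(1−xyz))` ↦ `6[Q]` — the landed equal-value instance `halfPointZetaTwoLogTwo`
  (`4∫dV/((2−x)(1−xyz)) = 3ζ(2)log 2` inside the calculus), then as before;
* `1/((1+x)(1+xyz))` ↦ `2[Z] − [Q]` — the sibling sub-goal `m3k_reduce_halfPoint`, rearranged;
* `2/((2−xy)(2−xyz))` ↦ `2[Z] − [Q]` — the landed duality `halfPointDuality` to the carrier `N7`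
  of the previous family, then `m3k_reduce_halfPoint` for `N7`.

Sources: M. Kontsevich, D. Zagier, *Periods* (2001), §1.1–1.2 (rules (1), (2)).
No definitions are introduced.
-/

noncomputable section

open MeasureTheory Set
open Literature.NumberTheory.Transcendental Literature.NumberTheory.Transcendental.KZ
open Literature.ModelTheory.ExponentialFields (IsSemialgebraic)

namespace Summit.KontsevichZagierPeriods.HurwitzMicroSectors.NormalFormPrinciple.PiBox.M3

/-- **Congruence on a common carrier.** Two representations on the same domain whose integrands
agree there with one and the same function differ by a relation (rule (1b) with a zero
representation). [cite: KontsevichZagier2001, §1.2 rule (1)] -/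
theorem m3d_of_sub_of_mem_relations {n : ℕ} {N Q : IntegralRep n} {s : Set (Fin n → ℝ)}
    {f : (Fin n → ℝ) → ℝ} (hNd : N.domain = s) (hNi : EqOn N.integrand f N.domain)
    (hQd : Q.domain = s) (hQi : EqOn Q.integrand f Q.domain) : of N - of Q ∈ relations :=
  of_sub_of_mem_relations_of_eqOn (hQd.trans hNd.symm) fun x hx => by
    have hxQ : x ∈ Q.domain := by rw [hQd, ← hNd]; exact hx
    rw [hNi hx, hQi hxQ]

/-- **Integer scaling is bookkeeping.** If the integrand of `N` is `k` times a function with which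
the integrand of `Q` agrees, on a common domain, then `[N] − k•[Q] ∈ KZ.relations`: congruence with
the scaled representation `Q.constMul k` followed by `[σ, k g] − k•[σ, g] ∈ relations` (iterated
integrand additivity). [cite: KontsevichZagier2001, §1.2 rule (1)] -/
theorem m3d_of_sub_nsmul_of_mem_relations {n : ℕ} (k : ℕ) {N Q : IntegralRep n}
    {s : Set (Fin n → ℝ)} {f : (Fin n → ℝ) → ℝ} (hNd : N.domain = s)
    (hNi : EqOn N.integrand (fun x => (k : ℝ) * f x) N.domain)
    (hQd : Q.domain = s) (hQi : EqOn Q.integrand f Q.domain) : of N - k • of Q ∈ relations := by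
  have h1 : of N - of (Q.constMul (k : ℝ) (isAlgebraic_nat k)) ∈ relations :=
    m3d_of_sub_of_mem_relations (f := fun x => (k : ℝ) * f x) hNd hNi
      (by rw [IntegralRep.domain_constMul, hQd]) fun x hx => by
        simp only [IntegralRep.integrand_constMul]
        rw [hQi hx]
  have h2 := IntegralRep.of_constMul_nat_sub_nsmul_mem_relations Q k
  have e : of N - k • of Q = (of N - of (Q.constMul (k : ℝ) (isAlgebraic_nat k))) +
      (of (Q.constMul (k : ℝ) (isAlgebraic_nat k)) - k • of Q) := by abel
  rw [e]
  exact relations.add_mem h1 h2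

/-- **Stub K3b (`m3k_reduce_log`; registered sub-goal of stmt-KontsevichZagierPeriods-3869, line
`SketchIdeator1`, M3 kernel capstone).** Given reference carriers `Z` of `[(0,1)³, 1/(1−xyz)]`,
`Q` of `[(0,1)³, 1/((1−xy)(1+z))]` and `N7` of `[(0,1)³, 1/((1+x)(1+xyz))]`, every carrier `N` of
each of the five box families `1/((1−xy)(1+z))`, `3/((1−xy)(1+z))`, `4/((2−x)(1−xyz))`,
`1/((1+x)(1+xyz))`, `2/((2−xy)(2−xyz))` satisfies `2[N] − (α[Z] + β[Q]) ∈ KZ.relations` with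
`(α, β) = (0,2), (0,6), (0,6), (2,−1), (2,−1)` respectively: congruence and integer scaling
(rule (1)), the landed equal-value instances `halfPointZetaTwoLogTwo` and `halfPointDuality`
(chains of rules (1), (2)), and the half-point reduction `m3k_reduce_halfPoint`.
[cite: KontsevichZagier2001, §1.2 rules (1), (2)] -/
theorem m3k_reduce_log :
    ∀ (Z Q N7 : IntegralRep 3),
      Z.domain = {x | ∀ i, x i ∈ Set.Ioo (0:ℝ) 1} → (Z.integrand = fun x => 1 / (1 - x 0 * x 1 * x 2)) →
      Q.domain = {x | ∀ i, x i ∈ Set.Ioo (0:ℝ) 1} → EqOn Q.integrand (fun x => 1 / ((1 - x 0 * x 1) * (1 + x 2))) Q.domain →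
      N7.domain = {x | ∀ i, x i ∈ Set.Ioo (0:ℝ) 1} → (N7.integrand = fun x => 1 / ((1 + x 0) * (1 + x 0 * x 1 * x 2))) →
        (∀ N : IntegralRep 3, N.domain = {x | ∀ i, x i ∈ Set.Ioo (0:ℝ) 1} →
          EqOn N.integrand (fun x => 1 / ((1 - x 0 * x 1) * (1 + x 2))) N.domain →
          (2:ℕ) • of N - ((0:ℤ) • of Z + (2:ℤ) • of Q) ∈ relations) ∧
        (∀ N : IntegralRep 3, N.domain = {x | ∀ i, x i ∈ Set.Ioo (0:ℝ) 1} →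
          EqOn N.integrand (fun x => 3 / ((1 - x 0 * x 1) * (1 + x 2))) N.domain →
          (2:ℕ) • of N - ((0:ℤ) • of Z + (6:ℤ) • of Q) ∈ relations) ∧
        (∀ N : IntegralRep 3, N.domain = {x | ∀ i, x i ∈ Set.Ioo (0:ℝ) 1} →
          EqOn N.integrand (fun x => 4 / ((2 - x 0) * (1 - x 0 * x 1 * x 2))) N.domain →
          (2:ℕ) • of N - ((0:ℤ) • of Z + (6:ℤ) • of Q) ∈ relations) ∧
        (∀ N : IntegralRep 3, N.domain = {x | ∀ i, x i ∈ Set.Ioo (0:ℝ) 1} →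
          EqOn N.integrand (fun x => 1 / ((1 + x 0) * (1 + x 0 * x 1 * x 2))) N.domain →
          (2:ℕ) • of N - ((2:ℤ) • of Z + (-1:ℤ) • of Q) ∈ relations) ∧
        (∀ N : IntegralRep 3, N.domain = {x | ∀ i, x i ∈ Set.Ioo (0:ℝ) 1} →
          EqOn N.integrand (fun x => 2 / ((2 - x 0 * x 1) * (2 - x 0 * x 1 * x 2))) N.domain →
          (2:ℕ) • of N - ((2:ℤ) • of Z + (-1:ℤ) • of Q) ∈ relations) := by
  intro Z Q N7 hZd hZi hQd hQi hN7d hN7i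
  -- the half-point reduction of family 7 (the sibling sub-goal `m3k_reduce_halfPoint`)
  have hHP : ∀ N : IntegralRep 3, N.domain = {x | ∀ i, x i ∈ Set.Ioo (0:ℝ) 1} →
      EqOn N.integrand (fun x => 1 / ((1 + x 0) * (1 + x 0 * x 1 * x 2))) N.domain →
      (2:ℤ) • of N - (2:ℤ) • of Z + of Q ∈ relations := fun N hNd hNi =>
    m3k_reduce_halfPoint N Z Q hNd hNi hZd (fun x _ => congrFun hZi x) hQd hQi
  refine ⟨fun N hNd hNi => ?_, fun N hNd hNi => ?_, fun N hNd hNi => ?_, fun N hNd hNi => ?_,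
    fun N hNd hNi => ?_⟩
  · -- family 11: congruence with `Q`
    have h := m3d_of_sub_of_mem_relations hNd hNi hQd hQi
    have e : (2:ℕ) • of N - ((0:ℤ) • of Z + (2:ℤ) • of Q) = (2:ℕ) • (of N - of Q) := by abel
    rw [e]
    exact relations.nsmul_mem h 2
  · -- family 9: congruence with `3•Q`
    have h := m3d_of_sub_nsmul_of_mem_relations 3 hNd (fun x hx => by rw [hNi hx]; push_cast; ring)
      hQd hQi
    have e : (2:ℕ) • of N - ((0:ℤ) • of Z + (6:ℤ) • of Q) = (2:ℕ) • (of N - 3 • of Q) := by abel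
    rw [e]
    exact relations.nsmul_mem h 2
  · -- family 8: the half-point identity `4∫dV/((2−x)(1−xyz)) = 3ζ(2)log 2`, then as family 9
    have hbox : ∀ x, x ∈ {x : Fin 3 → ℝ | ∀ i, x i ∈ Set.Ioo (0:ℝ) 1} → x ∈ Q.domain :=
      fun x hx => by rw [hQd]; exact hx
    have h1 : of N - of (Q.constMul ((3:ℕ) : ℝ) (isAlgebraic_nat 3)) ∈ relations :=
      halfPointZetaTwoLogTwo N (Q.constMul ((3:ℕ) : ℝ) (isAlgebraic_nat 3)) hNd
        (fun x hx => hNi (by rw [hNd]; exact hx))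
        (by rw [IntegralRep.domain_constMul, hQd]) fun x hx => by
          simp only [IntegralRep.integrand_constMul]
          rw [hQi (hbox x hx)]
          push_cast
          ring
    have h2 := IntegralRep.of_constMul_nat_sub_nsmul_mem_relations Q 3
    have e : (2:ℕ) • of N - ((0:ℤ) • of Z + (6:ℤ) • of Q) =
        (2:ℕ) • ((of N - of (Q.constMul ((3:ℕ) : ℝ) (isAlgebraic_nat 3))) +
          (of (Q.constMul ((3:ℕ) : ℝ) (isAlgebraic_nat 3)) - 3 • of Q)) := by abel
    rw [e]
    exact relations.nsmul_mem (relations.add_mem h1 h2) 2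
  · -- family 7: the sibling reduction, rearranged
    have h := hHP N hNd hNi
    have e : (2:ℕ) • of N - ((2:ℤ) • of Z + (-1:ℤ) • of Q) =
        (2:ℤ) • of N - (2:ℤ) • of Z + of Q := by abel
    rw [e]
    exact h
  · -- family 6: the duality `[2/((2−xy)(2−xyz))] ∼ [1/((1+x)(1+xyz))]`, then family 7 for `N7`
    have h1 : of N - of N7 ∈ relations :=
      halfPointDuality N N7 hNd (fun x hx => hNi (by rw [hNd]; exact hx)) hN7d
        fun x _ => congrFun hN7i x
    have h2 := hHP N7 hN7d fun x _ => congrFun hN7i x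
    have e : (2:ℕ) • of N - ((2:ℤ) • of Z + (-1:ℤ) • of Q) =
        (2:ℕ) • (of N - of N7) + ((2:ℤ) • of N7 - (2:ℤ) • of Z + of Q) := by abel
    rw [e]
    exact relations.add_mem (relations.nsmul_mem h1 2) h2

end Summit.KontsevichZagierPeriods.HurwitzMicroSectors.NormalFormPrinciple.PiBox.M3
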